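import Summits.BirchSwinnertonDyer.BirchSwinnertonDyer.Theorems.ThetaPartnerAtTwoSignedKatoUpToAtTwoPlusHondaLogPairingEnum
import Summits.BirchSwinnertonDyer.BirchSwinnertonDyer.Theorems.ThetaPartnerAtTwoSignedKatoUpToAtTwoKatoBKPairingCharSum
import Literature.NumberTheory.EllipticCurves.Kato2004.EulerSystemValues
import Literature.NumberTheory.EllipticCurves.PAdicPowerSeriesCharacterEvaluationProofs
import Mathlib.NumberTheory.Cyclotomic.PrimitiveRoots
import Mathlib.RingTheory.RootsOfUnity.Complex
import HarnessLib

/-!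
# Route `ThetaPartnerAtTwo` (TP2), crux K3 `SignedKatoDivisibilityUpToAtTwo` (stmt-BirchSwinnertonDyer-20308 / K3P′ 25631), line
# `colemanrat` v12 → v13 — assembly plumbing (lead's memo `G7-ASSEMBLY-v1`, brick B0): the embeddings `e_k : ℚ(ζ_{2^k}) → ℚ̄₂`
# (`ζ ↦ zeta 2 k`) and `ι_m : ℚ(ζ_m) → ℂ` (`ζ ↦ e^{2πi/m}`), the Galois representatives `τ_a`, the transport
# `τ_b • e(w) = e(σ_b w)` of Kato's `σ_b`, descent of finite-order characters along an injective ring map, and the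
# evaluation / non-membership facts for the constant multipliers `μ, ν ∈ Λ`

Lead prover `bsd-wall-tp2-p2x` g7 (cell `bsd-wall`). HONEST FRAMING: theorems only (no definition, no named fact, no instance, no
`sorry`); closes no item; K3 / K3P′ are NOT settled and BSD is NOT proved by any of this.

## What (all consumed by the lead's socket `KatoBK.corePairChiPrim_of_coreKBK`)

* §1 `exists_algHom_cyclotomicField_zeta_eq` — for every `k`, a `ℚ`-algebra map `e_k : CyclotomicField (cycLevel 2 k ∅) ℚ → ℚ̄₂` with
  `e_k(ζ) = zeta 2 k` (the tree's compatible `2`-power roots of unity in `ℚ̄₂`); `exists_ringHom_cyclotomicField_zeta_eq` /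
  `exists_ringHom_cyclotomicField_complex` — `ι_m : CyclotomicField m ℚ →+* ℂ` with `ι_m(ζ_m) = exp(2πi/m)` (every `m ≥ 1`; as a family
  pinned at the levels `m = cycLevel 2 k ∅`), so that Kato's `charSum`/Gauss sums match Mathlib's `stdAddChar`;
  `exists_tau_two` — representatives `τ_a ∈ Γ_{ℚ₂}` with `τ_a ζ_{2^m} = ζ_{2^m}^a` for every unit `a` (w4's `exists_smul_zeta_eq_pow_of_isUnit`).
* §2 `smul_algHom_eq_algHom_sigma` — **`ρ • e(w) = e(σ_b w)`** for `w ∈ ℚ(ζ_M)` whenever `ρ • e(ζ_M) = e(ζ_M)^b` (power-basis extensionality: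
  both sides are `ℚ`-algebra maps agreeing on `ζ_M`; `EulerSystemValues.sigma_apply_zeta`), and the character-sum form
  `sum_mul_smul_algHom_eq` «`Σ_b ψ(b)·τ_b • e(x) = e(Σ_b ψ_F(b)·σ_b x)`» for `ψ = e ∘ ψ_F`.
* §3 `exists_mulChar_ringHomComp_eq` — DESCENT: a multiplicative character `χ : (ℤ/M)ˣ → R'` all of whose values are `N`-th roots of
  unity factors through any injective `f : R →+* R'` from a domain `R` holding a primitive `N`-th root of unity (`χ = ψ.ringHomComp f`).
* §4 constants in `Λ = ℤ₂⟦T⟧`: `C_intCast_not_mem_of_ne_zero` (a non-zero integer constant avoids every prime `𝔭 ∌ 2`),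
  `hasSum_cpCoeff_C` (`(C c)(z) = c`).

References: [Kato2004Asterisque] (5.7.1) p. 157 (`σ_b ζ = ζ^b`), Thm. 6.6, Thm. 9.7, Thm. 12.5 (1); [Kobayashi2003] §8.4–8.6; [Washington1997] §7.2.
-/

set_option autoImplicit false
-- the Theorems namespace of this sub repeats the summit name by design (D-0017 nested layout)
set_option linter.dupNamespace false

noncomputable section

set_option backward.isDefEq.respectTransparency false

open scoped Classical NumberField

namespace Summit.BirchSwinnertonDyer.BirchSwinnertonDyer.Theorems.SignedKatoOffTwo.KatoBK

open Field NumberField IsDedekindDomain Polynomial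
  Literature.NumberTheory.GaloisRepresentations Literature.NumberTheory.EllipticCurves
  Literature.NumberTheory.EllipticCurves.Kato2004.EulerSystemValues
  Summit.BirchSwinnertonDyer.Rank1Residual.Additive.PadicCyclotomicTower

/-! ## §1 The embeddings `e_k`, `ι_m` and the representatives `τ_a` -/

section Embeddings

/-- `cycLevel 2 k ∅ = 2^k` (the pure `2`-power levels of Kato's family). [cite: Kato2004Asterisque, Ex. 13.3 (p. 225)] -/
theorem cycLevel_two_empty (k : ℕ) : cycLevel 2 k ∅ = 2 ^ k := by
  simp [cycLevel]

/-- **`e_k : ℚ(ζ_{2^k}) → ℚ̄₂` with `e_k(ζ) = zeta 2 k`.** For every `k` there is a `ℚ`-algebra map from Kato's value field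
`CyclotomicField (cycLevel 2 k ∅) ℚ` to `ℚ̄₂` sending the distinguished root `ζ` to the tree's `zeta 2 k` (a primitive `2^k`-th root of
unity in `ℚ̄₂`; `IsPrimitiveRoot.embeddingsEquivPrimitiveRoots`). [cite: Washington1997, §7.2] -/
theorem exists_algHom_cyclotomicField_zeta_eq :
    ∃ e : ∀ k : ℕ, CyclotomicField (cycLevel 2 k ∅) ℚ →ₐ[ℚ] PadicAlgCl 2,
      ∀ k, e k (IsCyclotomicExtension.zeta (cycLevel 2 k ∅) ℚ (CyclotomicField (cycLevel 2 k ∅) ℚ)) = zeta 2 k := by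
  have key : ∀ k : ℕ, ∃ e : CyclotomicField (cycLevel 2 k ∅) ℚ →ₐ[ℚ] PadicAlgCl 2,
      e (IsCyclotomicExtension.zeta (cycLevel 2 k ∅) ℚ (CyclotomicField (cycLevel 2 k ∅) ℚ)) = zeta 2 k := by
    intro k
    set n := cycLevel 2 k ∅ with hn
    have hn2 : n = 2 ^ k := cycLevel_two_empty k
    have hζ := IsCyclotomicExtension.zeta_spec n ℚ (CyclotomicField n ℚ)
    have hirr : Irreducible (cyclotomic n ℚ) := cyclotomic.irreducible_rat (NeZero.pos n)
    have hmem : zeta 2 k ∈ primitiveRoots n (PadicAlgCl 2) := by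
      rw [mem_primitiveRoots (NeZero.pos n), hn2]
      exact isPrimitiveRoot_zeta 2 k
    refine ⟨(hζ.embeddingsEquivPrimitiveRoots (PadicAlgCl 2) hirr).symm ⟨zeta 2 k, hmem⟩, ?_⟩
    have h := hζ.embeddingsEquivPrimitiveRoots_apply_coe (PadicAlgCl 2) hirr
      ((hζ.embeddingsEquivPrimitiveRoots (PadicAlgCl 2) hirr).symm ⟨zeta 2 k, hmem⟩)
    rw [Equiv.apply_symm_apply] at h
    exact h.symm
  choose e he using key
  exact ⟨e, he⟩

/-- `ι : ℚ(ζ_m) → ℂ` with `ι(ζ_m) = exp(2πi/m)` for `m ≥ 1`. [cite: Kato2004Asterisque, (5.7.1) (p. 157)] -/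
theorem exists_ringHom_cyclotomicField_zeta_eq (m : ℕ) [NeZero m] :
    ∃ ι : CyclotomicField m ℚ →+* ℂ,
      ι (IsCyclotomicExtension.zeta m ℚ (CyclotomicField m ℚ)) = Complex.exp (2 * Real.pi * Complex.I / m) := by
  have hζ := IsCyclotomicExtension.zeta_spec m ℚ (CyclotomicField m ℚ)
  have hirr : Irreducible (cyclotomic m ℚ) := cyclotomic.irreducible_rat (NeZero.pos m)
  have hmem : Complex.exp (2 * Real.pi * Complex.I / m) ∈ primitiveRoots m ℂ := by
    rw [mem_primitiveRoots (NeZero.pos m)]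
    exact Complex.isPrimitiveRoot_exp m (NeZero.ne m)
  refine ⟨((hζ.embeddingsEquivPrimitiveRoots ℂ hirr).symm ⟨_, hmem⟩).toRingHom, ?_⟩
  have h := hζ.embeddingsEquivPrimitiveRoots_apply_coe ℂ hirr ((hζ.embeddingsEquivPrimitiveRoots ℂ hirr).symm ⟨_, hmem⟩)
  rw [Equiv.apply_symm_apply] at h
  exact h.symm

/-- **`ι_m : ℚ(ζ_m) → ℂ` with `ι_m(ζ_m) = exp(2πi/m)` at every level `m = cycLevel 2 k ∅ = 2^k` of Kato's family** (and some embedding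
at the other `m`): the complex embeddings at which Kato's `charSum` / Gauss sums are Mathlib's `gaussSum … stdAddChar`.
[cite: Kato2004Asterisque, (5.7.1) (p. 157)] -/
theorem exists_ringHom_cyclotomicField_complex :
    ∃ ιC : (m : ℕ) → (CyclotomicField m ℚ →+* ℂ),
      ∀ k : ℕ, ιC (cycLevel 2 k ∅) (IsCyclotomicExtension.zeta (cycLevel 2 k ∅) ℚ (CyclotomicField (cycLevel 2 k ∅) ℚ)) =
        Complex.exp (2 * Real.pi * Complex.I / (cycLevel 2 k ∅ : ℕ)) := by
  classical
  refine ⟨fun m ↦ if hm : m = 0 then (IsAlgClosed.lift (R := ℚ) (S := CyclotomicField m ℚ) (M := ℂ)).toRingHom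
      else Classical.choose (@exists_ringHom_cyclotomicField_zeta_eq m ⟨hm⟩), fun k ↦ ?_⟩
  have hk : cycLevel 2 k ∅ ≠ 0 := NeZero.ne _
  simp only [dif_neg hk]
  exact Classical.choose_spec (@exists_ringHom_cyclotomicField_zeta_eq (cycLevel 2 k ∅) ⟨hk⟩)

/-- **Galois representatives `τ_a`**: for every `m` and every unit `a` mod `2^m` there is `τ_a ∈ Γ_{ℚ₂}` with `τ_a ζ_{2^m} = ζ_{2^m}^a`
(`Φ_{2^m}` is irreducible over `ℚ₂`; w4's `LocalVar.exists_smul_zeta_eq_pow_of_isUnit`), packaged as a function. [cite: Washington1997, §7.2] -/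
theorem exists_tau_two :
    ∃ τ : ∀ m : ℕ, ZMod (2 ^ m) → Field.absoluteGaloisGroup ℚ_[2],
      ∀ (m : ℕ) (a : ZMod (2 ^ m)), IsUnit a → τ m a • zeta 2 m = zeta 2 m ^ a.val := by
  have key : ∀ (m : ℕ) (a : ZMod (2 ^ m)), ∃ ρ : Field.absoluteGaloisGroup ℚ_[2], IsUnit a → ρ • zeta 2 m = zeta 2 m ^ a.val := by
    intro m a
    by_cases ha : IsUnit a
    · obtain ⟨ρ, hρ⟩ := LocalVar.exists_smul_zeta_eq_pow_of_isUnit m ha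
      exact ⟨ρ, fun _ ↦ hρ⟩
    · exact ⟨1, fun h ↦ absurd h ha⟩
  choose τ hτ using key
  exact ⟨τ, hτ⟩

end Embeddings

/-! ## §2 Transport of Kato's `σ_b` along `e`: `ρ • e(w) = e(σ_b w)` -/

section Sigma

/-- **`ρ • e(w) = e(σ_b w)`**: a `ℚ`-algebra map `e : ℚ(ζ_M) → ℚ̄₂` intertwines Kato's `σ_b` (`σ_b ζ = ζ^b`, (5.7.1)) with any
`ρ ∈ Γ_{ℚ₂}` raising `e(ζ_M)` to the `b`-th power — both `w ↦ ρ • e(w)` and `w ↦ e(σ_b w)` are `ℚ`-algebra maps out of the monogenic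
field `ℚ(ζ_M)` agreeing on `ζ_M` (`PowerBasis.algHom_ext`). [cite: Kato2004Asterisque, (5.7.1) (p. 157)] -/
theorem smul_algHom_eq_algHom_sigma {M : ℕ} [NeZero M] (e : CyclotomicField M ℚ →ₐ[ℚ] PadicAlgCl 2)
    (ρ : Field.absoluteGaloisGroup ℚ_[2]) (b : (ZMod M)ˣ)
    (hρ : ρ • e (IsCyclotomicExtension.zeta M ℚ (CyclotomicField M ℚ)) =
      e (IsCyclotomicExtension.zeta M ℚ (CyclotomicField M ℚ)) ^ (b : ZMod M).val)
    (w : CyclotomicField M ℚ) : ρ • e w = e (sigma M b w) := by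
  have hζ := IsCyclotomicExtension.zeta_spec M ℚ (CyclotomicField M ℚ)
  -- the two `ℚ`-algebra maps
  let F₁ : CyclotomicField M ℚ →ₐ[ℚ] PadicAlgCl 2 :=
    (((Field.absoluteGaloisGroup.toAlgEquiv ℚ_[2] ρ : PadicAlgCl 2 ≃ₐ[ℚ_[2]] PadicAlgCl 2).toRingEquiv.toRingHom.comp
      e.toRingHom).toRatAlgHom)
  let F₂ : CyclotomicField M ℚ →ₐ[ℚ] PadicAlgCl 2 := e.comp (sigma M b : CyclotomicField M ℚ →ₐ[ℚ] CyclotomicField M ℚ)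
  have h₁ : ∀ w, F₁ w = ρ • e w := fun w ↦ by
    rw [Field.absoluteGaloisGroup.smul_def]; rfl
  have h₂ : ∀ w, F₂ w = e (sigma M b w) := fun w ↦ rfl
  have hgen : F₁ (hζ.powerBasis ℚ).gen = F₂ (hζ.powerBasis ℚ).gen := by
    rw [IsPrimitiveRoot.powerBasis_gen, h₁, h₂, sigma_apply_zeta, map_pow, hρ]
  have hF : F₁ = F₂ := (hζ.powerBasis ℚ).algHom_ext hgen
  rw [← h₁, ← h₂, hF]

/-- **Character sums transport**: for `ψ_F : (ℤ/M)ˣ-character with values in ℚ(ζ_M)` and representatives `τ_b` with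
`τ_b • e(ζ_M) = e(ζ_M)^b`, `Σ_{b} e(ψ_F(b)) · τ_b • e(x) = e(Σ_b ψ_F(b) · σ_b x)` — Kato's `charSum` shape read in `ℚ̄₂`.
[cite: Kato2004Asterisque, Thm. 6.6 (1) (p. 163)] -/
theorem sum_mul_smul_algHom_eq {M : ℕ} [NeZero M] (e : CyclotomicField M ℚ →ₐ[ℚ] PadicAlgCl 2)
    (τ : ZMod M → Field.absoluteGaloisGroup ℚ_[2])
    (hτ : ∀ b : (ZMod M)ˣ, τ (b : ZMod M) • e (IsCyclotomicExtension.zeta M ℚ (CyclotomicField M ℚ)) =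
      e (IsCyclotomicExtension.zeta M ℚ (CyclotomicField M ℚ)) ^ (b : ZMod M).val)
    (ψF : MulChar (ZMod M) (CyclotomicField M ℚ)) (x : CyclotomicField M ℚ) :
    ∑ b : (ZMod M)ˣ, e (ψF (b : ZMod M)) * τ (b : ZMod M) • e x =
      e (∑ b : (ZMod M)ˣ, ψF (b : ZMod M) * sigma M b x) := by
  rw [map_sum]
  refine Finset.sum_congr rfl fun b _ ↦ ?_
  rw [map_mul, smul_algHom_eq_algHom_sigma e (τ (b : ZMod M)) b (hτ b) x]

end Sigma

/-! ## §3 Descent of finite-order characters along an injective ring map -/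

section Descent

/-- **Roots of unity descend along an injective map from a ring with a primitive root**: if `ζ ∈ R` is a primitive `N`-th root of
unity, `f : R →+* R'` is injective into a domain and `ω ∈ R'` has `ω^N = 1`, then `ω = f(ζ^i)` for some `i` (`f ζ` is a primitive
`N`-th root in `R'`, `IsPrimitiveRoot.eq_pow_of_pow_eq_one`). [cite: Washington1997, §7.2] -/
theorem exists_pow_eq_of_pow_eq_one {R R' : Type*} [CommRing R] [IsDomain R] [CommRing R'] [IsDomain R'] (f : R →+* R')
    (hf : Function.Injective f) {N : ℕ} (hN : 0 < N) {ζ : R} (hζ : IsPrimitiveRoot ζ N) {ω : R'} (hω : ω ^ N = 1) :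
    ∃ i : ℕ, i < N ∧ f (ζ ^ i) = ω := by
  haveI : NeZero N := ⟨hN.ne'⟩
  have hζ' : IsPrimitiveRoot (f ζ) N := hζ.map_of_injective hf
  obtain ⟨i, hi, h⟩ := hζ'.eq_pow_of_pow_eq_one hω
  exact ⟨i, hi, by rw [map_pow, h]⟩

/-- **Descent of a finite-order multiplicative character.** Let `f : R →+* R'` be injective between domains, `ζ ∈ R` a primitive `N`-th
root of unity (`N ≥ 1`), and `χ : MulChar (ZMod M) R'` with `χ(a)^N = 1` for every unit `a`. Then `χ = ψ.ringHomComp f` for a (unique)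
`ψ : MulChar (ZMod M) R`. (Values on units are `f`-images of powers of `ζ`; injectivity of `f` makes the lift multiplicative.)
[cite: Washington1997, §7.2] -/
theorem exists_mulChar_ringHomComp_eq {R R' : Type*} [CommRing R] [IsDomain R] [CommRing R'] [IsDomain R'] (f : R →+* R')
    (hf : Function.Injective f) {N : ℕ} (hN : 0 < N) {ζ : R} (hζ : IsPrimitiveRoot ζ N) {M : ℕ} [NeZero M]
    (χ : MulChar (ZMod M) R') (hχ : ∀ a : (ZMod M)ˣ, χ (a : ZMod M) ^ N = 1) :
    ∃ ψ : MulChar (ZMod M) R, ψ.ringHomComp f = χ := by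
  -- the lift on units
  have hval : ∀ a : (ZMod M)ˣ, ∃ r : R, f r = χ (a : ZMod M) := fun a ↦ by
    obtain ⟨i, -, hi⟩ := exists_pow_eq_of_pow_eq_one f hf hN hζ (hχ a)
    exact ⟨ζ ^ i, hi⟩
  choose r hr using hval
  have hr_unit : ∀ a : (ZMod M)ˣ, IsUnit (r a) := by
    intro a
    obtain ⟨i, -, hi⟩ := exists_pow_eq_of_pow_eq_one f hf hN hζ (hχ a)
    have : r a = ζ ^ i := hf (by rw [hr, hi])
    rw [this]
    exact (hζ.isUnit hN.ne').pow i
  -- multiplicativity via injectivity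
  let φ : (ZMod M)ˣ →* Rˣ :=
    { toFun := fun a ↦ (hr_unit a).unit
      map_one' := by
        apply Units.ext
        apply hf
        rw [IsUnit.unit_spec, Units.val_one, map_one, hr, Units.val_one, map_one]
      map_mul' := fun a b ↦ by
        apply Units.ext
        apply hf
        rw [IsUnit.unit_spec, Units.val_mul, map_mul, IsUnit.unit_spec, IsUnit.unit_spec, hr, hr, hr,
          Units.val_mul, map_mul] }
  refine ⟨MulChar.ofUnitHom φ, ?_⟩
  ext a
  rw [MulChar.ringHomComp_apply, MulChar.ofUnitHom_eq, MulChar.equivToUnitHom_symm_coe]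
  change f ((hr_unit a).unit : R) = χ a
  rw [IsUnit.unit_spec, hr]

end Descent

/-! ## §4 Constants in `Λ = ℤ₂⟦T⟧` -/

section Constants

/-- **A non-zero integer constant avoids every prime `𝔭 ∌ 2` of `Λ = ℤ₂⟦T⟧`**: `N = 2^v·u` with `u` odd, `C(u)` is a unit and
`C(2)^v ∉ 𝔭`. [cite: Washington1997, §7.1] -/
theorem C_intCast_not_mem_of_ne_zero {𝔭 : Ideal (PowerSeries ℤ_[2])} (h𝔭 : 𝔭.IsPrime)
    (h2 : PowerSeries.C (2 : ℤ_[2]) ∉ 𝔭) {N : ℤ} (hN : N ≠ 0) :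
    PowerSeries.C ((N : ℤ_[2])) ∉ 𝔭 := by
  -- `N = 2^v * u`, `u` odd
  obtain ⟨v, u, hu, rfl⟩ : ∃ (v : ℕ) (u : ℤ), ¬ 2 ∣ u ∧ N = 2 ^ v * u := by
    refine ⟨N.natAbs.factorization 2, N / 2 ^ N.natAbs.factorization 2, ?_, ?_⟩
    · intro h
      have hdvd : (2 : ℤ) ^ (N.natAbs.factorization 2 + 1) ∣ N := by
        have h1 : (2 : ℤ) ^ N.natAbs.factorization 2 ∣ N := by
          rw [← Int.natAbs_dvd_natAbs, Int.natAbs_pow]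
          exact Nat.ordProj_dvd N.natAbs 2
        obtain ⟨w, hw⟩ := h
        refine ⟨w, ?_⟩
        rw [pow_succ, mul_assoc, ← hw, Int.mul_ediv_cancel' h1]
      have h2' : ¬ (2 : ℕ) ^ (N.natAbs.factorization 2 + 1) ∣ N.natAbs :=
        Nat.pow_succ_factorization_not_dvd (Int.natAbs_ne_zero.mpr hN) Nat.prime_two
      apply h2'
      rw [← Int.natAbs_dvd_natAbs, Int.natAbs_pow] at hdvd
      exact hdvd
    · have h1 : (2 : ℤ) ^ N.natAbs.factorization 2 ∣ N := by
        rw [← Int.natAbs_dvd_natAbs, Int.natAbs_pow]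
        exact Nat.ordProj_dvd N.natAbs 2
      rw [Int.mul_ediv_cancel' h1]
  -- `u` is a `2`-adic unit
  have hu' : IsUnit ((u : ℤ_[2])) := by
    rw [PadicInt.isUnit_iff]
    by_contra hlt
    have hlt' : ‖(u : ℤ_[2])‖ < 1 := lt_of_le_of_ne (PadicInt.norm_le_one _) hlt
    rw [PadicInt.norm_int_lt_one_iff_dvd] at hlt'
    exact hu (by exact_mod_cast hlt')
  intro hmem
  rw [Int.cast_mul, Int.cast_pow, Int.cast_ofNat, map_mul, map_pow] at hmem
  rcases h𝔭.mem_or_mem hmem with h | h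
  · exact h2 (h𝔭.mem_of_pow_mem v h)
  · exact h𝔭.ne_top (Ideal.eq_top_of_isUnit_mem _ h ((hu'.map PowerSeries.C)))

/-- **Evaluating a constant**: `Σ_k ιZ(coeff_k (C c))·z^k = ιZ(c)` (only `k = 0` contributes). [cite: Washington1997, §7.2] -/
theorem hasSum_cpCoeff_C (c : ℤ_[2]) (z : ℂ_[2]) :
    HasSum (fun k ↦ ((algebraMap ℚ_[2] ℂ_[2]).comp (algebraMap ℤ_[2] ℚ_[2])) (PowerSeries.coeff k (PowerSeries.C c)) * z ^ k)
      (((algebraMap ℚ_[2] ℂ_[2]).comp (algebraMap ℤ_[2] ℚ_[2])) c) := by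
  have h : (fun k ↦ ((algebraMap ℚ_[2] ℂ_[2]).comp (algebraMap ℤ_[2] ℚ_[2])) (PowerSeries.coeff k (PowerSeries.C c)) * z ^ k) =
      fun k ↦ if k = 0 then ((algebraMap ℚ_[2] ℂ_[2]).comp (algebraMap ℤ_[2] ℚ_[2])) c else 0 := by
    funext k
    rw [PowerSeries.coeff_C]
    split_ifs with hk
    · rw [hk, pow_zero, mul_one]
    · rw [map_zero, zero_mul]
  rw [h]
  exact hasSum_ite_eq 0 _

end Constants

end Summit.BirchSwinnertonDyer.BirchSwinnertonDyer.Theorems.SignedKatoOffTwo.KatoBK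

end
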